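import Summits.QuantumFields.QCD.Theses.EulerDescent
import Literature.MathematicalPhysics.QuantumFieldTheory.QCDCurrentSector
import Summits.QuantumFields.QCD.Theorems.EulerDescentChiralCornerSoftnessStubSlabFluxBound
import HarnessLib

/-!
# Sub-goal `stub_twistedPPCeiling_centred` of stub `stub_twistedPPCeiling` (E2+E4), line `Sketch`
(twisted-ray Goldstone bound) of crux `Summit.QuantumFields.QCD.Theses.EulerDescent.ChiralCornerSoftness`
(item stmt-QuantumFields-16902)

**The charged one-point functions vanish in the twisted torus expectation.**  For `N_f` Wilson flavours on the
torus of side `2S+1`, a doublet `f ≠ g`, degenerate bare mass `m₀` and twisted mass `μ` on `(f,g)` (fermionic weight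
`W = e^{−ψ̄(D_W(U,m₀) + iμγ₅τ³)ψ}`, `τ³ = E_ff − E_gg`), the one-point functions of the CHARGED density
`P¹ = ψ̄γ₅τ¹ψ` (`pseudoscalarDensityObs Nf τ¹`) and of the time component of the charged conserved point-split current
`Ṽ²₀` (`conservedVectorCurrent Nf τ² 0`) vanish at every placement `v`:

  `⟨P¹(v)⟩_tw = 0`, `⟨Ṽ²₀(v)⟩_tw = 0`,

so that the zero-momentum correlator `C(s)` and the slab flux `Φ(s₀)` of the skeleton `Lines/Sketch.lean` are
automatically CONNECTED correlators (the form in which the twisted-gap clauses of E2+E4 and E3 are consumed).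

## Proof (everything is proved; no named fact)

The twisted action is FLAVOUR-DIAGONAL, hence invariant under the residual vector `U(1)` of flavour `f` (quark number
of flavour `f`), `ψ_f ↦ e^{iθ}ψ_f`, `ψ̄_f ↦ e^{−iθ}ψ̄_f`.  We use its infinitesimal form, with the Ward calculus landed
for E1 (`SlabFluxWard.wardOp`, `wardOp_quadQ`, `fermiIntegral_wardOp_add` of
`EulerDescentChiralCornerSoftnessStubSlabFluxBoundWardOp.lean`): for the number `N_f = diag(χ_f(flavour))` of
flavour `f` (more generally any flavour charge `diag(c(flavour))`), the Ward operator `δ = wardOp N_f` satisfies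
`∫ (δX) · e^{ψ̄Mψ} = −∫ X e^{ψ̄Mψ} ψ̄[M,N_f]ψ = 0` for every flavour-diagonal `M` (`[M, N_f] = 0`,
`flavDiag_comm_diagonal`), in particular for `M = −(D_W + iμγ₅τ³)` (`twDirac_comm_diagonal`).  A kernel `K`
supported on the two off-diagonal flavour blocks `(f,g)`, `(g,f)` of the doublet has charge `∓1` there, i.e. unit
squared charge `(χ_f(w) − χ_f(v))² K_{vw} = K_{vw}`, so `δ(δ(ψ̄Kψ)) = ψ̄[[K,N_f],N_f]ψ = ψ̄Kψ`
(`comm_comm_diagonal`), whence `∫ ψ̄Kψ · W = ∫ δ(δ(ψ̄Kψ)) · W = 0`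
(`fermiIntegral_quadQ_mul_grassmannExp_eq_zero_of_charge`).
The kernels of the placed `P¹(v)` and `Ṽ²₀(v)` (`densQ`, `currQ`; `densityObs_onTorus`, `currentObs_onTorus` of the
E1 file) carry the flavour matrices `τ¹`, `τ²`, which live on the two off-diagonal blocks.  The Berezin integral of
the numerator therefore vanishes at every gauge field, its Wilson-measure integral is `0`, and the expectation is
`0 / Z = 0` (also at a vanishing denominator, by the junk value of division).

References: I. Montvay, G. Münster, *Quantum Fields on a Lattice* (CUP 1994), §4.1 and §5.3.1 (5.146)–(5.150)
(fermionic Ward identities of flavour transformations); R. Frezzotti, P. A. Grassi, S. Sint, P. Weisz, JHEP 08 (2001)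
058, §2.1 (twisted-mass lattice QCD: the residual flavour symmetry generated by `τ³`); F. A. Berezin, *The Method of
Second Quantization* (1966), Ch. I §3.
-/

noncomputable section

namespace Summit.QuantumFields.QCD.Cruxes.ChiralCornerSoftness.TwistedRay

open Filter Topology MeasureTheory
open Literature.MathematicalPhysics.QuantumFieldTheory Literature.MathematicalPhysics.QuantumLattice
  Literature.Probability.LatticeModels

namespace SlabFluxWard

open Literature.MathematicalPhysics.QuantumLattice.GrassmannAlgebra

/-! ### §H The flavour-number Ward operator and the centring of charged bilinears -/

section Number

variable {Nf L : ℕ} [NeZero L]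

/-- Entries of the commutator with a diagonal charge matrix `C = diag(c)`: `[K, C]_{vw} = (c_w − c_v) K_{vw}`. [folklore] -/
theorem comm_diagonal_apply (K : Matrix (QuarkVar Nf L) (QuarkVar Nf L) ℂ) (c : QuarkVar Nf L → ℂ) (v w : QuarkVar Nf L) :
    (K * Matrix.diagonal c - Matrix.diagonal c * K) v w = (c w - c v) * K v w := by
  rw [Matrix.sub_apply, Matrix.mul_diagonal, Matrix.diagonal_mul]
  ring

/-- **A flavour-diagonal matrix commutes with every flavour charge** `diag(c(flavour))` (in particular with the
number `N_f` of flavour `f`, `c = χ_f`). [folklore] -/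
theorem flavDiag_comm_diagonal (F : Fin Nf → Matrix (TorusSite 4 L × Fin 3 × Fin 4) (TorusSite 4 L × Fin 3 × Fin 4) ℂ)
    (c : Fin Nf → ℂ) :
    flavDiag F * Matrix.diagonal (fun u : QuarkVar Nf L => c u.1) -
      Matrix.diagonal (fun u : QuarkVar Nf L => c u.1) * flavDiag F = 0 := by
  ext v w
  rw [comm_diagonal_apply, Matrix.zero_apply]
  simp only [flavDiag, Matrix.of_apply]
  by_cases h : v.1 = w.1
  · rw [h, sub_self, zero_mul]
  · rw [if_neg h, mul_zero]

/-- **The twisted Wilson–Dirac action is invariant under every flavour-diagonal charge rotation** (the residual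
vector symmetries of twisted-mass Wilson quarks): `[−(D_W(U,m₀) + iμγ₅τ³), diag(c(flavour))] = 0`.
[cite: FrezzottiGrassiSintWeisz2001, §2.1] -/
theorem twDirac_comm_diagonal (U : GaugeConfig 4 L (Matrix.specialUnitaryGroup (Fin 3) ℂ)) (m₀ μl : ℝ) (f g : Fin Nf)
    (c : Fin Nf → ℂ) :
    -(diracQ U m₀ + twistQ f g μl) * Matrix.diagonal (fun u : QuarkVar Nf L => c u.1) -
      Matrix.diagonal (fun u : QuarkVar Nf L => c u.1) * -(diracQ (Nf := Nf) U m₀ + twistQ f g μl) = 0 := by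
  have h1 := flavDiag_comm_diagonal (L := L) (fun _ : Fin Nf => wilsonDirac (fundamentalRep (Fin 3)) U m₀ 1) c
  have h2 := flavDiag_comm_diagonal (L := L) (fun f' : Fin Nf => twSign f g f' • twistBlock μl) c
  rw [← twistQ_eq_flavDiag] at h2
  rw [Matrix.neg_mul, Matrix.mul_neg, Matrix.add_mul, Matrix.mul_add, diracQ]
  rw [sub_eq_zero] at h1 h2 ⊢
  rw [h1, h2]

/-- `quadQ 0 = 0`. [folklore] -/
theorem quadQ_zero : quadQ (0 : Matrix (QuarkVar Nf L) (QuarkVar Nf L) ℂ) = 0 := by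
  simp [quadQ_eq_sum]

/-- **Ward identity of an invariant Gaussian weight**: if `[M, B] = 0` then `∫ (δ_B X) e^{ψ̄Mψ} = 0` for every
insertion `X`. [cite: MontvayMunster1994, §5.3.1 (5.150)] -/
theorem fermiIntegral_wardOp_mul_grassmannExp_eq_zero (B M : Matrix (QuarkVar Nf L) (QuarkVar Nf L) ℂ)
    (hMB : M * B - B * M = 0) (X : FermiAlg Nf L) : fermiIntegral (wardOp B X * grassmannExp (quadQ M)) = 0 := by
  have h := fermiIntegral_wardOp_add B M X
  rwa [hMB, quadQ_zero, mul_zero, mul_zero, map_zero, add_zero] at h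

/-- **A kernel of unit charge**, `(c_w − c_v)² K_{vw} = K_{vw}`, is reproduced by the double commutator:
`[[K, C], C] = K`. [folklore] -/
theorem comm_comm_diagonal (K : Matrix (QuarkVar Nf L) (QuarkVar Nf L) ℂ) (c : QuarkVar Nf L → ℂ)
    (hK : ∀ v w : QuarkVar Nf L, (c w - c v) ^ 2 * K v w = K v w) :
    (K * Matrix.diagonal c - Matrix.diagonal c * K) * Matrix.diagonal c -
      Matrix.diagonal c * (K * Matrix.diagonal c - Matrix.diagonal c * K) = K := by
  ext v w
  rw [comm_diagonal_apply, comm_diagonal_apply, ← mul_assoc, ← sq]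
  exact hK v w

/-- **Centring of charged bilinears**: the Berezin integral of a bilinear of unit charge against a Gaussian weight
invariant under that charge vanishes, `∫ ψ̄Kψ · e^{ψ̄Mψ} = ∫ δ(δ(ψ̄Kψ)) · e^{ψ̄Mψ} = 0`. [folklore] -/
theorem fermiIntegral_quadQ_mul_grassmannExp_eq_zero_of_charge (K M : Matrix (QuarkVar Nf L) (QuarkVar Nf L) ℂ)
    (c : QuarkVar Nf L → ℂ) (hK : ∀ v w : QuarkVar Nf L, (c w - c v) ^ 2 * K v w = K v w)
    (hM : M * Matrix.diagonal c - Matrix.diagonal c * M = 0) :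
    fermiIntegral (quadQ K * grassmannExp (quadQ M)) = 0 := by
  rw [← comm_comm_diagonal K c hK, ← wardOp_quadQ, ← wardOp_quadQ]
  exact fermiIntegral_wardOp_mul_grassmannExp_eq_zero _ M hM _

omit [NeZero L] in
/-- `τ¹` lives on the two off-diagonal blocks of the doublet. [folklore] -/
theorem tau1M_eq_zero {f g a b : Fin Nf} (h : ¬ ((a = f ∧ b = g) ∨ (a = g ∧ b = f))) : tau1M f g a b = 0 := by
  simp only [tau1M, Matrix.add_apply, Matrix.single_apply]
  rw [if_neg (fun hh => h (Or.inl ⟨hh.1.symm, hh.2.symm⟩)), if_neg (fun hh => h (Or.inr ⟨hh.1.symm, hh.2.symm⟩)),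
    add_zero]

omit [NeZero L] in
/-- `τ²` lives on the two off-diagonal blocks of the doublet. [folklore] -/
theorem tau2M_eq_zero {f g a b : Fin Nf} (h : ¬ ((a = f ∧ b = g) ∨ (a = g ∧ b = f))) : tau2M f g a b = 0 := by
  simp only [tau2M, Matrix.add_apply, Matrix.smul_apply, Matrix.single_apply, smul_eq_mul]
  rw [if_neg (fun hh => h (Or.inl ⟨hh.1.symm, hh.2.symm⟩)), if_neg (fun hh => h (Or.inr ⟨hh.1.symm, hh.2.symm⟩)),
    mul_zero, mul_zero, add_zero]

omit [NeZero L] in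
/-- **The two off-diagonal blocks of the doublet carry flavour-`f` number `∓1`** (`f ≠ g`). [folklore] -/
theorem numCharge_sq_eq_one {f g a b : Fin Nf} (hfg : f ≠ g) (h : (a = f ∧ b = g) ∨ (a = g ∧ b = f)) :
    ((if b = f then (1 : ℂ) else 0) - (if a = f then (1 : ℂ) else 0)) ^ 2 = 1 := by
  rcases h with ⟨rfl, rfl⟩ | ⟨rfl, rfl⟩
  · rw [if_neg hfg.symm, if_pos rfl]; norm_num
  · rw [if_pos rfl, if_neg hfg.symm]; norm_num

omit [NeZero L] in
/-- The kernel of the charged density `P¹(x)` has unit flavour-`f` number charge. [folklore] -/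
theorem numCharge_densQ {f g : Fin Nf} (hfg : f ≠ g) (x : TorusSite 4 L) (v w : QuarkVar Nf L) :
    ((if w.1 = f then (1 : ℂ) else 0) - (if v.1 = f then (1 : ℂ) else 0)) ^ 2 * densQ f g x v w = densQ f g x v w := by
  by_cases h : (v.1 = f ∧ w.1 = g) ∨ (v.1 = g ∧ w.1 = f)
  · rw [numCharge_sq_eq_one hfg h, one_mul]
  · rw [densQ_apply, tau1M_eq_zero h, zero_mul, ite_self, mul_zero]

omit [NeZero L] in
/-- The kernel of the charged conserved current `Ṽ²₀(x)` has unit flavour-`f` number charge. [folklore] -/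
theorem numCharge_currQ {f g : Fin Nf} (hfg : f ≠ g) (U : GaugeConfig 4 L (Matrix.specialUnitaryGroup (Fin 3) ℂ))
    (x : TorusSite 4 L) (v w : QuarkVar Nf L) :
    ((if w.1 = f then (1 : ℂ) else 0) - (if v.1 = f then (1 : ℂ) else 0)) ^ 2 * currQ f g U x v w =
      currQ f g U x v w := by
  by_cases h : (v.1 = f ∧ w.1 = g) ∨ (v.1 = g ∧ w.1 = f)
  · rw [numCharge_sq_eq_one hfg h, one_mul]
  · rw [currQ_apply, tau2M_eq_zero h, zero_mul, zero_mul, ite_self, ite_self, sub_zero, mul_zero, mul_zero]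

/-- **`∫ P¹(v) · W = 0` at every gauge field**, `W` the twisted weight of the statement. [folklore] -/
theorem fermiIntegral_density_twWeight {f g : Fin Nf} (hfg : f ≠ g) (v : Literature.Probability.LatticeModels.Site 4)
    (U : GaugeConfig 4 L (Matrix.specialUnitaryGroup (Fin 3) ℂ)) (m₀ μl : ℝ) :
    fermiIntegral ((pseudoscalarDensityObs Nf (tau1M f g)).onTorus L v U *
      grassmannExp (quadratic ℂ (-(diracMatrix U (fun _ : Fin Nf => m₀) +
        Matrix.reindex quarkEquiv quarkEquiv (twistQ f g μl))))) = 0 := by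
  rw [twWeight_eq, densityObs_onTorus]
  exact fermiIntegral_quadQ_mul_grassmannExp_eq_zero_of_charge _ _
    (fun u : QuarkVar Nf L => if u.1 = f then (1 : ℂ) else 0) (numCharge_densQ hfg _)
    (twDirac_comm_diagonal U m₀ μl f g fun f' => if f' = f then (1 : ℂ) else 0)

/-- **`∫ Ṽ²₀(v) · W = 0` at every gauge field**, `W` the twisted weight of the statement. [folklore] -/
theorem fermiIntegral_current_twWeight {f g : Fin Nf} (hfg : f ≠ g) (v : Literature.Probability.LatticeModels.Site 4)
    (U : GaugeConfig 4 L (Matrix.specialUnitaryGroup (Fin 3) ℂ)) (m₀ μl : ℝ) :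
    fermiIntegral ((conservedVectorCurrent Nf (tau2M f g) 0).onTorus L v U *
      grassmannExp (quadratic ℂ (-(diracMatrix U (fun _ : Fin Nf => m₀) +
        Matrix.reindex quarkEquiv quarkEquiv (twistQ f g μl))))) = 0 := by
  rw [twWeight_eq, currentObs_onTorus]
  exact fermiIntegral_quadQ_mul_grassmannExp_eq_zero_of_charge _ _
    (fun u : QuarkVar Nf L => if u.1 = f then (1 : ℂ) else 0) (numCharge_currQ hfg U _)
    (twDirac_comm_diagonal U m₀ μl f g fun f' => if f' = f then (1 : ℂ) else 0)

end Number

/-! ### §I The twisted torus expectations of the charged density and current vanish -/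

section Expect

variable {Nf : ℕ}

/-- **`⟨P¹(v)⟩_tw = 0`**: the twisted torus expectation of the charged density vanishes at every placement.
[folklore] -/
theorem twExpect_density_eq_zero {f g : Fin Nf} (hfg : f ≠ g) (β m₀ μl : ℝ) (S : ℕ)
    (v : Literature.Probability.LatticeModels.Site 4) :
    (∫ U, fermiIntegral ((pseudoscalarDensityObs Nf (tau1M f g)).onTorus (2 * S + 1) v U *
          grassmannExp (quadratic ℂ (-(diracMatrix U (fun _ : Fin Nf => m₀) +
            Matrix.reindex quarkEquiv quarkEquiv (twistQ f g μl)))))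
        ∂(wilsonMeasure (d := 4) (L := 2 * S + 1) (fundamentalRep (Fin 3)) β)) /
      (∫ U, fermiIntegral (grassmannExp (quadratic ℂ (-(diracMatrix U (fun _ : Fin Nf => m₀) +
          Matrix.reindex quarkEquiv quarkEquiv (twistQ f g μl)))))
        ∂(wilsonMeasure (d := 4) (L := 2 * S + 1) (fundamentalRep (Fin 3)) β)) = 0 := by
  simp only [fermiIntegral_density_twWeight hfg, integral_zero, zero_div]

/-- **`⟨Ṽ²₀(v)⟩_tw = 0`**: the twisted torus expectation of the charged conserved current vanishes at every
placement. [folklore] -/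
theorem twExpect_current_eq_zero {f g : Fin Nf} (hfg : f ≠ g) (β m₀ μl : ℝ) (S : ℕ)
    (v : Literature.Probability.LatticeModels.Site 4) :
    (∫ U, fermiIntegral ((conservedVectorCurrent Nf (tau2M f g) 0).onTorus (2 * S + 1) v U *
          grassmannExp (quadratic ℂ (-(diracMatrix U (fun _ : Fin Nf => m₀) +
            Matrix.reindex quarkEquiv quarkEquiv (twistQ f g μl)))))
        ∂(wilsonMeasure (d := 4) (L := 2 * S + 1) (fundamentalRep (Fin 3)) β)) /
      (∫ U, fermiIntegral (grassmannExp (quadratic ℂ (-(diracMatrix U (fun _ : Fin Nf => m₀) +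
          Matrix.reindex quarkEquiv quarkEquiv (twistQ f g μl)))))
        ∂(wilsonMeasure (d := 4) (L := 2 * S + 1) (fundamentalRep (Fin 3)) β)) = 0 := by
  simp only [fermiIntegral_current_twWeight hfg, integral_zero, zero_div]

end Expect

end SlabFluxWard

open SlabFluxWard in
/-- **Sub-goal `stub_twistedPPCeiling_centred` of (E2+E4) — the charged one-point functions vanish in the twisted
torus expectation.**  For the twisted-mass Wilson doublet `(f,g)`, `f ≠ g` (weight `e^{−ψ̄(D_W(U,m₀) + iμγ₅τ³)ψ}`),
the one-point functions of the charged density `P¹ = ψ̄γ₅τ¹ψ` and of the charged conserved current `Ṽ²₀` vanish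
at every placement `v` on every torus `2S+1`, for all `β, m₀, μ`: `⟨P¹(v)⟩_tw = 0 = ⟨Ṽ²₀(v)⟩_tw` — the exact Ward
identity of the residual flavour-`f` number symmetry of the (flavour-diagonal) twisted action, under which both
bilinears carry charge `∓1` on their two flavour blocks.  Hence the skeleton's `C(s)` and `Φ(s₀)` are connected
correlators. [cite: MontvayMunster1994, §5.3.1 (5.146)–(5.150)] [cite: FrezzottiGrassiSintWeisz2001, §2.1] -/
theorem stub_twistedPPCeiling_centred :
    ∀ (Nf : ℕ) (f g : Fin Nf), f ≠ g → let τ1 : Matrix (Fin Nf) (Fin Nf) ℂ := Matrix.single f g 1 + Matrix.single g f 1; let τ2 : Matrix (Fin Nf) (Fin Nf) ℂ := (-Complex.I) • Matrix.single f g 1 + Complex.I • Matrix.single g f 1; let P1 : QCDLatticeObservable Nf 1 := pseudoscalarDensityObs Nf τ1; let V2 : QCDLatticeObservable Nf 1 := conservedVectorCurrent Nf τ2 0; let Tw := fun (S : ℕ) (μl : ℝ) => Matrix.reindex (quarkEquiv (Nf := Nf) (L := 2 * S + 1)) quarkEquiv (Matrix.of fun v w : QuarkVar Nf (2 * S + 1)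 => if v.1 = w.1 ∧ v.2.1 = w.2.1 ∧ v.2.2.1 = w.2.2.1 then (if v.1 = f then (1 : ℂ) else if v.1 = g then -1 else 0) * ((μl : ℂ) * Complex.I) * gammaFive v.2.2.2 w.2.2.2 else 0); let E := fun (β m₀ μl : ℝ) (S : ℕ) (X : GaugeConfig 4 (2 * S + 1) (Matrix.specialUnitaryGroup (Fin 3) ℂ) → FermiAlg Nf (2 * S + 1)) => (∫ U, fermiIntegral (X U * grassmannExp (quadratic ℂ (-(diracMatrix U (fun _ : Fin Nf => m₀) + Tw S μl)))) ∂(wilsonMeasure (d := 4) (L := 2 * S + 1) (fundamentalRep (Fin 3)) β)) / (∫ U, fermiIntegral (grassmannExp (quadratic ℂ (-(diracMatrix U (fun _ : Fin Nf => m₀) + Tw S μl)))) ∂(wilsonMeasure (d := 4) (L := 2 * S + 1) (fundamentalRep (Fin 3)) β)); ∀ (β m₀ μl : ℝ) (S : ℕ) (v : Literature.Probability.LatticeModels.Site 4), E β m₀ μl S (P1.onTorus (2 * S + 1) v) = 0 ∧ E β m₀ μl S (V2.onTorus (2 * S + 1) v) = 0 := by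
  intro Nf f g hfg
  dsimp only
  intro β m₀ μl S v
  exact ⟨twExpect_density_eq_zero hfg β m₀ μl S v, twExpect_current_eq_zero hfg β m₀ μl S v⟩

end Summit.QuantumFields.QCD.Cruxes.ChiralCornerSoftness.TwistedRay
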